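import Mathlib.Algebra.Homology.DerivedCategory.Ext.TStructure
import Mathlib.CategoryTheory.Triangulated.TStructure.TruncLTGE
import HarnessLib

/-!
# Morphisms between bounded complexes in the derived category are small

Mathlib defines `Abelian.Ext X Y n` as a *shrunk* type of morphisms `X[0] ⟶ Y[0]⟦n⟧` in the
derived category, under the hypothesis `HasExt.{w} C` that these types are `w`-small, and proves
(`Mathlib.Algebra.Homology.DerivedCategory.Ext.TStructure`) that the same smallness holds between
two complexes each *cohomologically concentrated in one degree*; the extension to bounded complexes
is left there as a TODO. This file proves it, by devissage along the truncation triangles of the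
canonical t-structure on `DerivedCategory C` (`Mathlib.Algebra.Homology.DerivedCategory.TStructure`,
`Mathlib.CategoryTheory.Triangulated.TStructure.TruncLTGE`):

* `small_hom_of_distTriang`, `small_hom_of_distTriang'` — in a pretriangulated category, if the
  outer Hom-types out of (into) a distinguished triangle are small so is the middle one;
* `small_hom_of_isGE_of_isLE` — `Hom_{D(C)}(X, Y)` is `w`-small for `X`, `Y` cohomologically
  bounded, given `HasExt.{w} C`;
* `small_hom_of_isGE` — the same for `X` bounded and `Y` only bounded *below* (maps out of an
  object of `D^{≤ a'}` factor through the truncation `τ^{< a'+1} Y`);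
* `hasSmallLocalizedShiftedHom_of_isGE_of_isLE` — for cochain complexes `K` (cohomologically in
  `[a, a']`) and `L` (cohomologically `≥ b`), `HasSmallLocalizedShiftedHom.{w} (quasiIso) ℤ K L`,
  i.e. `SmallShiftedHom.{w} _ K L n : Type w` is available. This is the input for hyper-Ext groups /
  hypercohomology of bounded-below complexes (`Literature/Algebra/Homology/HyperExt.lean`).

All statements are standard consequences of the axioms of t-structures
(Beilinson–Bernstein–Deligne) and carry `[folklore]`.
-/

universe w w' v u

open CategoryTheory Limits Pretriangulated Triangulated Localization

namespace Literature.Algebra.Homology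


/-! ### Small Hom-types and distinguished triangles -/

section Zero

variable {D : Type*} [Category D]

/-- Morphisms out of a zero object form a small type. [folklore] -/
theorem small_hom_of_isZero_src {A : D} (hA : IsZero A) (B : D) : Small.{w} (A ⟶ B) :=
  small_of_injective (f := fun _ : A ⟶ B => PUnit.unit.{w + 1}) fun x y _ => hA.eq_of_src x y

/-- Morphisms into a zero object form a small type. [folklore] -/
theorem small_hom_of_isZero_tgt (A : D) {B : D} (hB : IsZero B) : Small.{w} (A ⟶ B) :=
  small_of_injective (f := fun _ : A ⟶ B => PUnit.unit.{w + 1}) fun x y _ => hB.eq_of_tgt x y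

end Zero

section Pretriangulated

variable {D : Type*} [Category D] [Preadditive D] [HasZeroObject D] [HasShift D ℤ]
  [∀ n : ℤ, (shiftFunctor D n).Additive] [Pretriangulated D]

/-- If `T` is a distinguished triangle and the types of morphisms `A ⟶ T.obj₁` and
`A ⟶ T.obj₃` are `w`-small, so is `A ⟶ T.obj₂` (an extension of a subgroup of a small group by
a quotient of a small group). [folklore] -/
theorem small_hom_of_distTriang (T : Triangle D) (hT : T ∈ distTriang D) (A : D)
    (h₁ : Small.{w} (A ⟶ T.obj₁)) (h₃ : Small.{w} (A ⟶ T.obj₃)) : Small.{w} (A ⟶ T.obj₂) := by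
  let φ : (A ⟶ T.obj₂) → (A ⟶ T.obj₃) := fun f => f ≫ T.mor₂
  have hs : ∀ c : Set.range φ, ∃ f, φ f = c := fun c => c.2
  choose s hs using hs
  refine small_of_surjective
    (f := fun p : (A ⟶ T.obj₁) × Set.range φ => p.1 ≫ T.mor₁ + s p.2) ?_
  intro f
  obtain ⟨g, hg⟩ := Triangle.coyoneda_exact₂ T hT (f - s ⟨φ f, f, rfl⟩) (by
    have := hs ⟨φ f, f, rfl⟩
    simp only [φ] at this
    simp only [Preadditive.sub_comp, this, φ, sub_self])
  exact ⟨⟨g, ⟨φ f, f, rfl⟩⟩, by simp only [← hg, sub_add_cancel]⟩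

/-- If `T` is a distinguished triangle and the types of morphisms `T.obj₁ ⟶ B` and
`T.obj₃ ⟶ B` are `w`-small, so is `T.obj₂ ⟶ B`. [folklore] -/
theorem small_hom_of_distTriang' (T : Triangle D) (hT : T ∈ distTriang D) (B : D)
    (h₁ : Small.{w} (T.obj₁ ⟶ B)) (h₃ : Small.{w} (T.obj₃ ⟶ B)) : Small.{w} (T.obj₂ ⟶ B) := by
  let φ : (T.obj₂ ⟶ B) → (T.obj₁ ⟶ B) := fun f => T.mor₁ ≫ f
  have hs : ∀ c : Set.range φ, ∃ f, φ f = c := fun c => c.2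
  choose s hs using hs
  refine small_of_surjective
    (f := fun p : (T.obj₃ ⟶ B) × Set.range φ => T.mor₂ ≫ p.1 + s p.2) ?_
  intro f
  obtain ⟨g, hg⟩ := Triangle.yoneda_exact₂ T hT (f - s ⟨φ f, f, rfl⟩) (by
    have := hs ⟨φ f, f, rfl⟩
    simp only [φ] at this
    simp only [Preadditive.comp_sub, this, φ, sub_self])
  exact ⟨⟨g, ⟨φ f, f, rfl⟩⟩, by simp only [← hg, sub_add_cancel]⟩

end Pretriangulated

/-! ### Devissage in the derived category -/

section Derived

variable {C : Type u} [Category.{v} C] [Abelian C] [HasDerivedCategory.{w'} C] [HasExt.{w} C]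

open DerivedCategory DerivedCategory.TStructure

/-- Two objects of the derived category, each with cohomology in a single degree, have a
`w`-small type of morphisms as soon as `HasExt.{w} C`. [folklore] -/
theorem small_hom_of_isGE_of_isLE_self (X Y : DerivedCategory C) (a b : ℤ)
    [X.IsGE a] [X.IsLE a] [Y.IsGE b] [Y.IsLE b] : Small.{w} (X ⟶ Y) := by
  obtain ⟨X', ⟨eX⟩⟩ := exists_iso_singleFunctor_obj_of_isGE_of_isLE X a
  obtain ⟨Y', ⟨eY⟩⟩ := exists_iso_singleFunctor_obj_of_isGE_of_isLE Y b
  exact small_map (Iso.homCongr eX eY)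

/-- Induction on the amplitude of the source, target in a single degree. [folklore] -/
theorem small_hom_of_amplitude_src (Y : DerivedCategory C) (b : ℤ) [Y.IsGE b] [Y.IsLE b]
    (k : ℕ) : ∀ (X : DerivedCategory C) (a : ℤ) [X.IsGE a] [X.IsLE (a + k)],
      Small.{w} (X ⟶ Y) := by
  induction k with
  | zero =>
    intro X a _ hX
    have : X.IsLE a := by simpa using hX
    exact small_hom_of_isGE_of_isLE_self X Y a b
  | succ k hk =>
    intro X a _ _
    have h₁ : t.IsLE ((t.truncLT (a + k + 1)).obj X) (a + k) := inferInstance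
    have h₃ : t.IsLE ((t.truncGE (a + k + 1)).obj X) (a + k + 1) := by
      have : t.IsLE X (a + k + 1) := by
        rw [add_assoc]; exact (inferInstance : X.IsLE (a + (↑k + 1 : ℕ)))
      infer_instance
    exact small_hom_of_distTriang' _ (t.triangleLTGE_distinguished (a + k + 1) X) Y
      (hk ((t.truncLT (a + k + 1)).obj X) a)
      (small_hom_of_isGE_of_isLE_self.{w} ((t.truncGE (a + k + 1)).obj X) Y (a + k + 1) b)

/-- Induction on the amplitude of the target, source bounded. [folklore] -/
theorem small_hom_of_amplitude_tgt (X : DerivedCategory C) (a : ℤ) (k : ℕ) [X.IsGE a]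
    [X.IsLE (a + k)] (l : ℕ) :
    ∀ (Y : DerivedCategory C) (b : ℤ) [Y.IsGE b] [Y.IsLE (b + l)], Small.{w} (X ⟶ Y) := by
  induction l with
  | zero =>
    intro Y b _ hY
    have : Y.IsLE b := by simpa using hY
    exact small_hom_of_amplitude_src Y b k X a
  | succ l hl =>
    intro Y b _ _
    have h₁ : t.IsLE ((t.truncLT (b + l + 1)).obj Y) (b + l) := inferInstance
    have h₃ : t.IsLE ((t.truncGE (b + l + 1)).obj Y) (b + l + 1) := by
      have : t.IsLE Y (b + l + 1) := by
        rw [add_assoc]; exact (inferInstance : Y.IsLE (b + (↑l + 1 : ℕ)))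
      infer_instance
    exact small_hom_of_distTriang _ (t.triangleLTGE_distinguished (b + l + 1) Y) X
      (hl ((t.truncLT (b + l + 1)).obj Y) b)
      (small_hom_of_amplitude_src.{w} ((t.truncGE (b + l + 1)).obj Y) (b + l + 1) k X a)

/-- **Morphisms between cohomologically bounded objects of the derived category are small**
(given `HasExt.{w} C`, i.e. smallness between objects in single degrees): the TODO of
`Mathlib.Algebra.Homology.DerivedCategory.Ext.TStructure`. [folklore] -/
theorem small_hom_of_isGE_of_isLE (X Y : DerivedCategory C) (a a' b b' : ℤ)
    [X.IsGE a] [X.IsLE a'] [Y.IsGE b] [Y.IsLE b'] : Small.{w} (X ⟶ Y) := by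
  by_cases ha : a ≤ a'
  · obtain ⟨k, rfl⟩ := Int.le.dest ha
    by_cases hb : b ≤ b'
    · obtain ⟨l, rfl⟩ := Int.le.dest hb
      exact small_hom_of_amplitude_tgt X a k l Y b
    · exact small_hom_of_isZero_tgt X (t.isZero Y b' b (by lia))
  · exact small_hom_of_isZero_src (t.isZero X a' a (by lia)) Y

/-- Morphisms from a cohomologically bounded object to a cohomologically bounded below object
of the derived category are small (given `HasExt.{w} C`): they factor through a bounded
truncation of the target. [folklore] -/
theorem small_hom_of_isGE (X Y : DerivedCategory C) (a a' b : ℤ)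
    [X.IsGE a] [X.IsLE a'] [Y.IsGE b] : Small.{w} (X ⟶ Y) := by
  have := small_hom_of_isGE_of_isLE.{w} X ((t.truncLT (a' + 1)).obj Y) a a' b a'
  refine small_of_injective (f := fun f : X ⟶ Y => t.liftTruncLT f a' (a' + 1) rfl) ?_
  intro f g h
  dsimp only at h
  rw [← t.liftTruncLT_ι f a' (a' + 1) rfl, h, t.liftTruncLT_ι g a' (a' + 1) rfl]

end Derived

section Complexes

variable {C : Type u} [Category.{v} C] [Abelian C]

open DerivedCategory

/-- **Smallness of shifted morphisms between a bounded and a bounded-below complex** in the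
localization at quasi-isomorphisms, from `HasExt.{w} C`: if `K` is cohomologically
concentrated in degrees `[a, a']` and `L` in degrees `≥ b`, then all
`Hom_{D(C)}(K⟦p⟧, L⟦q⟧)` are `w`-small. [folklore] -/
theorem hasSmallLocalizedShiftedHom_of_isGE_of_isLE [HasExt.{w} C] (K L : CochainComplex C ℤ)
    (a a' b : ℤ) [K.IsGE a] [K.IsLE a'] [L.IsGE b] :
    HasSmallLocalizedShiftedHom.{w} (HomologicalComplex.quasiIso C (ComplexShape.up ℤ)) ℤ
      K L := by
  letI := HasDerivedCategory.standard C
  rw [hasSmallLocalizedShiftedHom_iff _ _ Q]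
  intro p q
  have : ((Q.obj K)⟦p⟧).IsGE (a - p) := TStructure.t.isGE_shift _ a p (a - p) (by lia)
  have : ((Q.obj K)⟦p⟧).IsLE (a' - p) := TStructure.t.isLE_shift _ a' p (a' - p) (by lia)
  have : ((Q.obj L)⟦q⟧).IsGE (b - q) := TStructure.t.isGE_shift _ b q (b - q) (by lia)
  exact small_hom_of_isGE ((Q.obj K)⟦p⟧) ((Q.obj L)⟦q⟧) (a - p) (a' - p) (b - q)

end Complexes


end Literature.Algebra.Homology
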